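import Summits.PneNP.PneNP.Theorems.ChebyshevTracialDesignTiltedSmallBlock
import Summits.PneNP.PneNP.Theorems.ChebyshevTracialDesignTiltedSmallBlockClassSplit
import Summits.PneNP.PneNP.Theorems.ChebyshevTracialDesignShellOperatorForm
import Literature.Combinatorics.Optimization.ShellLawSmoothing
import HarnessLib

/-!
# Cell pnp-psdrank, route `ChebyshevTracialDesign`: TILTED SMALL BLOCKS WITH INTERNAL EDGES — every type-constant direction,
# per matching, effective (brick 152; crux `TracialDecayExp20`, stmt-PneNP-19878)

Brick 152 (prover g30; eng MEMO-26 §4 «small blocks in all directions, effectively», prover MEMO-32 §8 (iii-a), MEMO-33 §2).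
For a block `H` with `a` internal and `b` crossing edges of a matching `M` and a TYPE-CONSTANT direction `v` (`u₂` on the
`HH`-type vertices, `u₁` on the mixed, `u₀` on the `H̄H̄`-type ones) the (CG_1′) containment form
`Σ_U W(U,M)·ψ(|U∩H|)·(Σ_p v_p x_p x_{πp})²` is split along the `HH` class `K = V(AA)` (brick 152a
`shellAvg_eq_sum_classWeight_mul_avg`, T-K4b's class weights `p_{fg}`): on the pattern `(f, g)` the cut `U = A ∪ B` has
`|U∩H| = 2f+g+|B∩H|` and `Σ_p v_p x_p x_{πp}(U) = 2u₂f + Σ_p u'_p x_p x_{πp}(B)` with the crossing-plane weight `u'`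
(§1 `containment_union_pattern`), and on the reduced shell `Shell_{[n]∖K}(t−2f−g, c−g)` lit's `crossingWeight_containment_eq` turns the
latter into `2(u₁−u₀)(X−Y) + u₀(t−2f−c)`: each class is brick 151's object with `λ = u₁−u₀`, `κ = u₀`, `L = 2u₂f + u₀(t−2f)`.

* §1 `containment_union_pattern`.
* §2 **`smallBlockHH_tilted_designValue_le`**: for an exact design `(n,t,T,D,B_v,C,w)`, `M`, `H` of type `(a,b,·)`, `t = 2s₀+1`,
  `a + 2 + D′ = D`, `a ≤ T`, `R ≥ 1`, `R + 3(D′+1) + b + a + (T−1)/2 ≤ s₀`, `R + 3(D′+1) + b + a + s₀ + (T−1)/2 + 2 ≤ N`,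
  `(b/R)²e^{3b/R} ≤ 2`, `0 ≤ ψ ≤ G` on `[0,t]`, `|u₂|,|u₁|,|u₀| ≤ 1`:
  `|PM|·Σ_U W(U,M)·ψ(|U∩H|)·(Σ_p v_p x_p x_{πp})² ≤ B_v·C((T−1)/2, D′+1)·3^a·G·(5t+5T+4)²·(¼(b/R)²e^{3b/R})^{D′+1}`
  (T-K4b's architecture with brick 151 in place of the untilted class pricing; `Σ_{f,g} C(a,f)C(a−f,g) = 3^a`).
READING (MEMO-33 §2): the tilted companion of T-K4b `smallBlockHH_designValue_le` — (CG_1′) for a small block with internal edges in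
EVERY type-constant direction, PER MATCHING, EFFECTIVE (no `∃ n₀`), losing `q²·(5t+5T+4)²`; input of the `M`-average (brick 153) and,
via bricks 148 §4 / 150b, of the all-directions bound / 𝒜₁ rung for small blocks. WHAT THIS FILE DOES NOT DO: the `M`-average,
non-type-constant directions; anything on `TracialDecayExp20` itself, psd rank of P_PM(K_n), or P vs NP.
[cite: Rothvoss2017, §2 (PDF p. 6)] [cite: Agarwal2000DifferenceEquations, Remark 1.8.1 (1.8.8)]
[cite: ChattamvelliShanmugam2020, §7.4 (PDF p. 144), multivariate hypergeometric law]
Stature: support/instrument (kernel lane, no defs, axioms standard). Supports stmt-PneNP-19878.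
-/

set_option linter.dupNamespace false -- `Summit.PneNP.PneNP.…`: summit = sub-problem (D-0017)

noncomputable section

namespace Summit.PneNP.PneNP.Theorems.ChebyshevTracialDesignTiltedSmallBlockClasses

open Finset Polynomial Literature.Barriers.PneNP Literature.Combinatorics.Optimization
open Literature.Combinatorics.Optimization.ShellStep
open Summit.PneNP.PneNP.Theorems.ChebyshevTracialDesignShellOperatorForm (designValue_eq_shellAvg)
open Summit.PneNP.PneNP.Theorems.ChebyshevTracialDesignSmallBlockClassWeights
open Summit.PneNP.PneNP.Theorems.ChebyshevTracialDesignSmallBlockMaskPricingHH (sdiff_vAA_facts)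
open Summit.PneNP.PneNP.Theorems.ChebyshevTracialDesignTiltedSmallBlockTools
open Summit.PneNP.PneNP.Theorems.ChebyshevTracialDesignTiltedSmallBlock (tiltedSmallBlock_levelSum_le)
open Summit.PneNP.PneNP.Theorems.ChebyshevTracialDesignTiltedSmallBlockClassSplit

variable {n : ℕ}

/-! ### §1 The containment form on a class pattern -/

section Pattern

variable {π : Fin n → Fin n} (hπ : ∀ v, π (π v) = v)
include hπ

/-- **The type-constant containment form splits along the `HH` class.** For `K = V(AA)` (the vertices of `S = [n]` on `HH` edges),
`A ⊆ K`, `B ⊆ [n] ∖ K`, and a type-constant direction `v` (`u₂` on `HH`-type, `u₁` on mixed, `u₀` on `H̄H̄`-type vertices):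
`Σ_p v_p x_p x_{πp}(A ∪ B) = u₂·(|A| − |half A|) + Σ_p u'_p x_p x_{πp}(B)` with the crossing-plane weight
`u'_p = (u₁−u₀)([p∈H][πp∈H] − [p∉H][πp∉H]) + u₁`, and `|(A∪B) ∩ H| = |A| + |B ∩ H|`. [cite: Rothvoss2017, §2 (PDF pp. 5–6)] -/
theorem containment_union_pattern (H : Finset (Fin n)) (v : Fin n → ℝ) (u₂ u₁ u₀ : ℝ)
    (hvA : ∀ p, p ∈ H → π p ∈ H → v p = u₂) (hvB : ∀ p, (p ∈ H ∧ π p ∉ H) ∨ (p ∉ H ∧ π p ∈ H) → v p = u₁)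
    (hvD : ∀ p, p ∉ H → π p ∉ H → v p = u₀) {A B : Finset (Fin n)} (hA : A ⊆ vAA π univ H)
    (hB : B ⊆ univ \ vAA π univ H) :
    (((A ∪ B) ∩ H).card : ℝ) = (A.card : ℝ) + ((B ∩ H).card : ℝ) ∧
    ∑ p : Fin n, v p * ((if p ∈ A ∪ B then (1 : ℝ) else 0) * (if π p ∈ A ∪ B then (1 : ℝ) else 0)) =
      u₂ * ((A.card : ℝ) - ((half π A).card : ℝ)) +
        ∑ p : Fin n, ((u₁ - u₀) * ((if (p ∈ H ∧ π p ∈ H) then (1 : ℝ) else 0) - (if (p ∉ H ∧ π p ∉ H) then (1 : ℝ) else 0)) + u₁) *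
          ((if p ∈ B then (1 : ℝ) else 0) * (if π p ∈ B then (1 : ℝ) else 0)) := by
  classical
  have hK : ∀ p, p ∈ vAA π univ H ↔ p ∈ H ∧ π p ∈ H := fun p => by rw [mem_vAA]; simp
  have hAK : ∀ p ∈ A, p ∈ H ∧ π p ∈ H := fun p hp => (hK p).1 (hA hp)
  have hBK : ∀ p ∈ B, ¬ (p ∈ H ∧ π p ∈ H) := fun p hp => fun h => (mem_sdiff.1 (hB hp)).2 ((hK p).2 h)
  have hdisj : Disjoint A B := disjoint_left.2 fun p hpA hpB => hBK p hpB (hAK p hpA)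
  constructor
  · have e : (A ∪ B) ∩ H = A ∪ (B ∩ H) := by
      ext p; simp only [mem_inter, mem_union]
      constructor
      · rintro ⟨hp | hp, hH⟩
        · exact Or.inl hp
        · exact Or.inr ⟨hp, hH⟩
      · rintro (hp | ⟨hp, hH⟩)
        · exact ⟨Or.inl hp, (hAK p hp).1⟩
        · exact ⟨Or.inr hp, hH⟩
    rw [e, card_union_of_disjoint (disjoint_of_subset_right inter_subset_left hdisj)]; push_cast; ring
  · -- pointwise: `x_p x_{πp}(A∪B) = x_p x_{πp}(A) + x_p x_{πp}(B)`
    have hpt : ∀ p : Fin n, v p * ((if p ∈ A ∪ B then (1 : ℝ) else 0) * (if π p ∈ A ∪ B then (1 : ℝ) else 0)) =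
        u₂ * (if p ∈ full π A then (1 : ℝ) else 0) +
        ((u₁ - u₀) * ((if (p ∈ H ∧ π p ∈ H) then (1 : ℝ) else 0) - (if (p ∉ H ∧ π p ∉ H) then (1 : ℝ) else 0)) + u₁) *
          ((if p ∈ B then (1 : ℝ) else 0) * (if π p ∈ B then (1 : ℝ) else 0)) := by
      intro p
      by_cases hpA : p ∈ A
      · have hpK := hAK p hpA
        have hpB : p ∉ B := fun h => hBK p h hpK
        have hπpB : π p ∉ B := fun h => hBK (π p) h ⟨hpK.2, by rw [hπ]; exact hpK.1⟩
        rw [if_pos (mem_union_left _ hpA), if_neg hpB, hvA p hpK.1 hpK.2]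
        by_cases hπpA : π p ∈ A
        · rw [if_pos (mem_union_left _ hπpA), if_pos (mem_full.2 ⟨hpA, hπpA⟩)]; ring
        · rw [if_neg (fun h => (mem_union.1 h).elim hπpA hπpB), if_neg (fun h => hπpA (mem_full.1 h).2)]; ring
      · rw [if_neg (fun h => hpA (mem_full.1 h).1)]
        by_cases hpB : p ∈ B
        · have hpK := hBK p hpB
          have hπpA : π p ∉ A := fun h => hpK (by have := hAK _ h; rw [hπ] at this; exact ⟨this.2, this.1⟩)
          rw [if_pos (mem_union_right _ hpB), if_pos hpB]
          by_cases hπpB : π p ∈ B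
          · rw [if_pos (mem_union_right _ hπpB), if_pos hπpB]
            have hv : v p = (u₁ - u₀) * ((if (p ∈ H ∧ π p ∈ H) then (1 : ℝ) else 0) -
                (if (p ∉ H ∧ π p ∉ H) then (1 : ℝ) else 0)) + u₁ := by
              rw [if_neg hpK]
              by_cases h1 : p ∈ H
              · have h2 : π p ∉ H := fun h => hpK ⟨h1, h⟩
                rw [hvB p (Or.inl ⟨h1, h2⟩), if_neg (fun h => h.1 h1)]; ring
              · by_cases h2 : π p ∈ H
                · rw [hvB p (Or.inr ⟨h1, h2⟩), if_neg (fun h => h.2 h2)]; ring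
                · rw [hvD p h1 h2, if_pos ⟨h1, h2⟩]; ring
            rw [hv]; ring
          · rw [if_neg (fun h => (mem_union.1 h).elim hπpA hπpB), if_neg hπpB]; ring
        · rw [if_neg (fun h => (mem_union.1 h).elim hpA hpB), if_neg hpB]; ring
    rw [Fintype.sum_congr _ _ hpt, sum_add_distrib, ← mul_sum]
    congr 1
    have hF : ∑ p : Fin n, (if p ∈ full π A then (1 : ℝ) else 0) = ((full π A).card : ℝ) := by
      rw [sum_boole, filter_mem_eq_inter, univ_inter]
    rw [hF]
    have h3 := card_full_add_card_half (π := π) A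
    have : ((full π A).card : ℝ) = (A.card : ℝ) - ((half π A).card : ℝ) := by
      have e : ((full π A).card : ℝ) + ((half π A).card : ℝ) = (A.card : ℝ) := by exact_mod_cast h3
      linarith
    rw [this]

end Pattern

/-! ### §2 The per-matching pricing for blocks WITH internal edges -/

section Main

/-- **TILTED SMALL BLOCKS WITH INTERNAL EDGES, PER MATCHING, EVERY TYPE-CONSTANT DIRECTION (brick 152).** For an exact design
`(n,t,T,D,B_v,C,w)`, a perfect matching `M` of `[n]` (`n = 2N`), a block `H` with `a` internal and `b` crossing `M`-edges,
`t = 2s₀+1`, `a + 2 + D′ = D`, `a ≤ T`, `R ≥ 1` with `R + 3(D′+1) + b + a + (T−1)/2 ≤ s₀`, `R + 3(D′+1) + b + a + s₀ + (T−1)/2 + 2 ≤ N`,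
`(b/R)²e^{3b/R} ≤ 2`, a mask `0 ≤ ψ ≤ G` on `[0,t]`, and a TYPE-CONSTANT direction `v` (`u₂` on the `HH`-type vertices, `u₁` on the
mixed ones, `u₀` on the `H̄H̄`-type ones, all in `[−1,1]`):
`|PM|·Σ_U W(U,M)·ψ(|U∩H|)·(Σ_p v_p x_p x_{πp})² ≤ B_v·C((T−1)/2, D′+1)·3^a·G·(5t+5T+4)²·(¼(b/R)²e^{3b/R})^{D′+1}`.
Proof = the `HH`-class split (brick 152a) + §1 + lit `crossingWeight_containment_eq` ⇒ per class the crossing-plane form on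
`[n] ∖ V(AA)` with T-K4b's class weight ⇒ brick 151 per class ⇒ `Σ_{f,g} C(a,f)C(a−f,g) = 3^a`.
[cite: Rothvoss2017, §2 (PDF p. 6)] [cite: Agarwal2000DifferenceEquations, Remark 1.8.1 (1.8.8)]
[cite: ChattamvelliShanmugam2020, §7.4] -/
theorem smallBlockHH_tilted_designValue_le {t T D : ℕ} {Bv : ℝ} {C : Finset ℕ} {w : ℕ → ℝ}
    (hdes : IsExactDesign n t T D Bv C w) (M : PMatch n) {N : ℕ} (hn : (univ : Finset (Fin n)).card = 2 * N)
    (H : Finset (Fin n)) {a b : ℕ} (ha : (reps M.2.partner (vAA M.2.partner univ H)).card = a)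
    (hb : (reps M.2.partner (vBH M.2.partner univ H ∪ vBN M.2.partner univ H)).card = b)
    {s₀ D' R : ℕ} (ht : t = 2 * s₀ + 1) (hD : a + 2 + D' = D) (haT : a ≤ T) (hR : 1 ≤ R)
    (hR1 : R + 3 * (D' + 1) + b + a + (T - 1) / 2 ≤ s₀) (hR2 : R + 3 * (D' + 1) + b + a + s₀ + (T - 1) / 2 + 2 ≤ N)
    (hq : ((b : ℝ) / R) ^ 2 * Real.exp (3 * b / R) ≤ 2)
    (ψ : ℤ → ℝ) {G : ℝ} (hG : ∀ x ∈ Icc (0 : ℤ) (t : ℤ), |ψ x| ≤ G) (hψ0 : ∀ x ∈ Icc (0 : ℤ) (t : ℤ), 0 ≤ ψ x)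
    (v : Fin n → ℝ) (u₂ u₁ u₀ : ℝ) (hu₂ : |u₂| ≤ 1) (hu₁ : |u₁| ≤ 1) (hu₀ : |u₀| ≤ 1)
    (hvA : ∀ p, p ∈ H → M.2.partner p ∈ H → v p = u₂)
    (hvB : ∀ p, (p ∈ H ∧ M.2.partner p ∉ H) ∨ (p ∉ H ∧ M.2.partner p ∈ H) → v p = u₁)
    (hvD : ∀ p, p ∉ H → M.2.partner p ∉ H → v p = u₀) :
    (Fintype.card (PMatch n) : ℝ) * ∑ U : OddSet n, levelWeight n t C w U M *
        (ψ ((U.1 ∩ H).card : ℤ) *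
          (∑ p : Fin n, v p * ((if p ∈ U.1 then (1 : ℝ) else 0) * (if M.2.partner p ∈ U.1 then (1 : ℝ) else 0))) ^ 2) ≤
      Bv * ((((T - 1) / 2).choose (D' + 1) : ℕ) : ℝ) *
        ((3 : ℝ) ^ a * (G * (5 * (t : ℝ) + 5 * T + 4) ^ 2 *
          ((1 / 4 : ℝ) * ((b : ℝ) / R) ^ 2 * Real.exp (3 * b / R)) ^ (D' + 1))) := by
  classical
  subst ht
  set π := M.2.partner with hπdef
  have hπ : ∀ v, π (π v) = v := partner_partner M
  have hπ' : ∀ v, π v ≠ v := partner_ne M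
  obtain ⟨hS', hN', h0', hB'⟩ := sdiff_vAA_facts hπ hπ' hn H ha
  set S' := univ \ vAA π univ H with hS'def
  have hb' : (reps π (vBH π S' H ∪ vBN π S' H)).card = b := by rw [hB', hb]
  have huniv : ∀ v ∈ (univ : Finset (Fin n)), π v ∈ univ := fun v _ => mem_univ _
  have hK : ∀ v ∈ vAA π univ H, π v ∈ vAA π univ H := vAA_stable hπ univ H huniv
  have hG0 : 0 ≤ G := (abs_nonneg _).trans (hG 0 (mem_Icc.2 ⟨le_rfl, by positivity⟩))
  have hBv : 0 ≤ Bv := (sum_nonneg fun c _ => abs_nonneg (w c)).trans hdes.variation_le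
  have hTt : T ≤ 2 * s₀ + 1 := hdes.2.2.1
  have haN : a ≤ N := by omega
  set q : ℝ := (1 / 4 : ℝ) * ((b : ℝ) / R) ^ 2 * Real.exp (3 * b / R) with hqdef
  have hq0 : 0 ≤ q := by rw [hqdef]; positivity
  set Kc : ℝ := ((((T - 1) / 2).choose (D' + 1) : ℕ) : ℝ) with hKc
  have hKc0 : 0 ≤ Kc := Nat.cast_nonneg _
  -- crossing-plane data of the direction
  set lam : ℝ := u₁ - u₀ with hlamdef
  have hlam : |lam| ≤ 2 := by
    have h1 := abs_le.1 hu₁; have h0 := abs_le.1 hu₀; rw [hlamdef, abs_le]; constructor <;> linarith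
  set Lf : ℕ → ℝ := fun f => 2 * u₂ * (f : ℝ) + u₀ * (((2 * s₀ + 1 : ℕ) : ℝ) - 2 * (f : ℝ)) with hLfdef
  have hLf : ∀ f, f ≤ a → |Lf f| ≤ ((2 * s₀ + 1 : ℕ) : ℝ) := by
    intro f hfa
    have hf2 : 2 * (f : ℝ) ≤ ((2 * s₀ + 1 : ℕ) : ℝ) := by exact_mod_cast (show 2 * f ≤ 2 * s₀ + 1 by omega)
    have hf0 : (0 : ℝ) ≤ f := Nat.cast_nonneg f
    have h1 : |2 * u₂ * (f : ℝ)| ≤ 2 * f := by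
      rw [abs_mul, abs_mul, abs_two, abs_of_nonneg hf0]; have := mul_le_mul_of_nonneg_right hu₂ hf0; linarith
    have h2 : |u₀ * (((2 * s₀ + 1 : ℕ) : ℝ) - 2 * (f : ℝ))| ≤ ((2 * s₀ + 1 : ℕ) : ℝ) - 2 * f := by
      rw [abs_mul, abs_of_nonneg (by linarith : (0:ℝ) ≤ ((2 * s₀ + 1 : ℕ) : ℝ) - 2 * (f : ℝ))]
      exact mul_le_of_le_one_left (by linarith) hu₀
    rw [hLfdef]; exact (abs_add_le _ _).trans (by linarith)
  -- the crossing-plane weight of the direction outside the `HH` class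
  set cw : Fin n → ℝ := fun p' => (u₁ - u₀) * ((if (p' ∈ H ∧ π p' ∈ H) then (1 : ℝ) else 0) -
    (if (p' ∉ H ∧ π p' ∉ H) then (1 : ℝ) else 0)) + u₁ with hcwdef
  -- the cut function, its shell profile, the pattern function, the class profiles, the class weights
  set F : Finset (Fin n) → ℝ := fun U => ψ ((U ∩ H).card : ℤ) *
    (∑ p' : Fin n, v p' * ((if p' ∈ U then (1 : ℝ) else 0) * (if π p' ∈ U then (1 : ℝ) else 0))) ^ 2 with hFdef
  set φ : ℕ → ℝ := fun c => (∑ U ∈ shellIn π univ (2 * s₀ + 1) c, F U) / ((shellIn π univ (2 * s₀ + 1) c).card : ℝ)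
    with hφ
  set ΦP : ℕ → ℕ → Finset (Fin n) → ℝ := fun t₁ c₁ B => ψ (((B ∩ H).card : ℤ) + ((t₁ : ℕ) : ℤ)) *
    (u₂ * ((t₁ : ℝ) - (c₁ : ℝ)) + ∑ p' : Fin n, cw p' * ((if p' ∈ B then (1 : ℝ) else 0) *
      (if π p' ∈ B then (1 : ℝ) else 0))) ^ 2 with hΦPdef
  have hF : ∀ A B, A ⊆ vAA π univ H → B ⊆ univ \ vAA π univ H → F (A ∪ B) = ΦP A.card (half π A).card B := by
    intro A B hA hB
    obtain ⟨h1, h2⟩ := containment_union_pattern hπ H v u₂ u₁ u₀ hvA hvB hvD hA hB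
    rw [hFdef, hΦPdef]; simp only; rw [h2]
    have h1n : ((A ∪ B) ∩ H).card = A.card + (B ∩ H).card := by exact_mod_cast h1
    have h1' : (((A ∪ B) ∩ H).card : ℤ) = ((B ∩ H).card : ℤ) + ((A.card : ℕ) : ℤ) := by
      rw [h1n]; push_cast; ring
    rw [h1']
  set Φ : ℕ → ℕ → ℕ → ℝ := fun f g c =>
    (∑ B ∈ shellIn π S' (2 * s₀ + 1 - (2 * f + g)) (c - g),
        (fun x : ℤ => ψ (x + ((2 * f + g : ℕ) : ℤ))) ((B ∩ H).card : ℤ) *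
          (2 * lam * (((B ∩ H).card : ℝ) - ((half π B ∩ H).card : ℝ)) + Lf f - u₀ * c) ^ 2) /
      ((shellIn π S' (2 * s₀ + 1 - (2 * f + g)) (c - g)).card : ℝ) with hΦ
  set p : ℕ → ℕ → ℝ[X] := fun f g => Polynomial.C (((a.choose f : ℕ) : ℝ) * ((a - f).choose g : ℕ) /
      (N.descFactorial a : ℕ)) *
    (∏ i ∈ range f, (Polynomial.C ((((2 * s₀ + 1 : ℕ) : ℝ)) / 2 - i) - Polynomial.C (1 / 2 : ℝ) * X)) *
    (∏ i ∈ range g, (X - Polynomial.C (i : ℝ))) *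
    (∏ i ∈ range (a - f - g), (Polynomial.C ((N : ℝ) - (((2 * s₀ + 1 : ℕ) : ℝ)) / 2 - i) - Polynomial.C (1 / 2 : ℝ) * X))
    with hp
  have hlev : ∀ c ∈ C, ∃ j : ℕ, c = 2 * j + 1 ∧ j ≤ (T - 1) / 2 ∧ j ≤ s₀ := by
    intro c hc
    obtain ⟨⟨j, hj⟩, _, hcT, _⟩ := hdes.2.2.2.1 c hc
    exact ⟨j, by omega, by omega, by omega⟩
  -- STEP A: the class decomposition `φ(c) = Σ_{f,g} p_{fg}(c)·Φ_{fg}(c)` on the levels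
  have hsplit : ∀ c ∈ C, φ c = ∑ f ∈ range (a + 1), ∑ g ∈ range (a - f + 1), (p f g).eval (c : ℝ) * Φ f g c := by
    intro c hc
    obtain ⟨j, rfl, hjT, hjs⟩ := hlev c hc
    have hsc : 2 * (s₀ - j) + (2 * j + 1) = 2 * s₀ + 1 := by omega
    have hsN : (s₀ - j) + (2 * j + 1) ≤ N := by omega
    rw [hφ]
    simp only
    rw [← hsc, shellAvg_eq_sum_classWeight_mul_avg hπ hπ' huniv hn hK (subset_univ _) ha (s₀ - j) (2 * j + 1) hsN F ΦP hF]
    refine sum_congr rfl fun f hf => sum_congr rfl fun g hg => ?_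
    have hf' : f ≤ a := Nat.lt_succ_iff.1 (mem_range.1 hf)
    have hg' : g ≤ a - f := Nat.lt_succ_iff.1 (mem_range.1 hg)
    rw [hp]
    simp only
    rw [classWeight_eval_level _ hsc hsN f g (a - f - g)]
    by_cases hfs : f ≤ s₀ - j ∧ g ≤ 2 * j + 1
    · -- an honest class: the reduced containment form is the crossing-plane form
      have e1 : 2 * (s₀ - j - f) + (2 * j + 1 - g) = 2 * s₀ + 1 - (2 * f + g) := by omega
      have hin : ∀ B ∈ shellIn π S' (2 * (s₀ - j - f) + (2 * j + 1 - g)) (2 * j + 1 - g),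
          ΦP (2 * f + g) g B = (fun x : ℤ => ψ (x + ((2 * f + g : ℕ) : ℤ))) ((B ∩ H).card : ℤ) *
            (2 * lam * (((B ∩ H).card : ℝ) - ((half π B ∩ H).card : ℝ)) + Lf f - u₀ * ((2 * j + 1 : ℕ) : ℝ)) ^ 2 := by
        intro B hB
        rw [hΦPdef]
        simp only
        rw [hcwdef, crossingWeight_containment_eq hπ H hB (u₁ - u₀) u₁]
        congr 1
        have c1 : (((2 * f + g : ℕ) : ℕ) : ℝ) - (g : ℝ) = 2 * f := by push_cast; ring
        have c2 : (((2 * (s₀ - j - f) + (2 * j + 1 - g) : ℕ) : ℝ) - ((2 * j + 1 - g : ℕ) : ℝ)) =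
            2 * (s₀ : ℝ) - 2 * f - 2 * j := by
          rw [Nat.cast_add, Nat.cast_mul, Nat.cast_sub (by omega : f ≤ s₀ - j), Nat.cast_sub hjs]
          push_cast; ring
        rw [c1, c2, hLfdef, hlamdef]
        simp only
        push_cast
        ring
      rw [hΦ]
      simp only
      rw [← e1, sum_congr rfl hin]
      ring
    · -- an impossible class: its weight vanishes
      have hz : ((s₀ - j).descFactorial f : ℝ) * ((2 * j + 1).descFactorial g : ℕ) = 0 := by
        rcases not_and_or.1 hfs with h1 | h1
        · rw [Nat.descFactorial_eq_zero_iff_lt.2 (by omega), Nat.cast_zero, zero_mul]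
        · rw [Nat.descFactorial_eq_zero_iff_lt.2 (by omega : 2 * j + 1 < g), Nat.cast_zero, mul_zero]
      have e1 : (((a.choose f : ℕ) : ℝ) * ((a - f).choose g : ℕ) * ((s₀ - j).descFactorial f : ℕ) *
          ((2 * j + 1).descFactorial g : ℕ) * ((N - (s₀ - j) - (2 * j + 1)).descFactorial (a - f - g) : ℕ) /
          (N.descFactorial a : ℕ)) = 0 := by
        rw [show (((a.choose f : ℕ) : ℝ) * ((a - f).choose g : ℕ) * ((s₀ - j).descFactorial f : ℕ) *
          ((2 * j + 1).descFactorial g : ℕ)) = ((a.choose f : ℕ) : ℝ) * ((a - f).choose g : ℕ) *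
          ((((s₀ - j).descFactorial f : ℕ) : ℝ) * ((2 * j + 1).descFactorial g : ℕ)) by ring, hz]
        simp
      have e2 : ((a.choose f : ℕ) : ℝ) * ((a - f).choose g : ℕ) / (N.descFactorial a : ℕ) *
          ((s₀ - j).descFactorial f : ℕ) * ((2 * j + 1).descFactorial g : ℕ) *
          ((N - (s₀ - j) - (2 * j + 1)).descFactorial (a - f - g) : ℕ) = 0 := by
        rw [show ((a.choose f : ℕ) : ℝ) * ((a - f).choose g : ℕ) / (N.descFactorial a : ℕ) *
          ((s₀ - j).descFactorial f : ℕ) * ((2 * j + 1).descFactorial g : ℕ) =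
          ((a.choose f : ℕ) : ℝ) * ((a - f).choose g : ℕ) / (N.descFactorial a : ℕ) *
          ((((s₀ - j).descFactorial f : ℕ) : ℝ) * ((2 * j + 1).descFactorial g : ℕ)) by ring, hz]
        simp
      rw [e1, e2, zero_mul, zero_mul]
  -- STEP B: each class is priced by brick 151
  have hclass : ∀ f ∈ range (a + 1), ∀ g ∈ range (a - f + 1),
      ∑ c ∈ C, w c * ((p f g).eval (c : ℝ) * Φ f g c) ≤
        Bv * (((a.choose f : ℕ) : ℝ) * ((a - f).choose g : ℕ)) * Kc *
          (G * (5 * ((2 * s₀ + 1 : ℕ) : ℝ) + 5 * T + 4) ^ 2 * q ^ (D' + 1)) := by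
    intro f hf g hg
    have hf' : f ≤ a := Nat.lt_succ_iff.1 (mem_range.1 hf)
    have hg' : g ≤ a - f := Nat.lt_succ_iff.1 (mem_range.1 hg)
    have hfge : f + g + (a - f - g) = a := by omega
    have hgdm := Nat.div_add_mod g 2
    have hgm : g % 2 < 2 := Nat.mod_lt _ (by norm_num)
    have ht' : 2 * (s₀ - f - g / 2) + (1 - g % 2) = 2 * s₀ + 1 - (2 * f + g) := by omega
    -- hypotheses of brick 151 for this class
    have hdeg : (p f g).natDegree + 2 + D' ≤ D := by
      have h := natDegree_classWeight_le (((a.choose f : ℕ) : ℝ) * ((a - f).choose g : ℕ) / (N.descFactorial a : ℕ))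
        ((((2 * s₀ + 1 : ℕ) : ℝ)) / 2) ((N : ℝ) - (((2 * s₀ + 1 : ℕ) : ℝ)) / 2) f g (a - f - g)
      simp only [hp]; omega
    have hP : ∀ c ∈ C, |(p f g).eval (c : ℝ)| ≤ ((a.choose f : ℕ) : ℝ) * ((a - f).choose g : ℕ) := by
      intro c hc
      obtain ⟨j, rfl, hjT, hjs⟩ := hlev c hc
      have hsc : 2 * (s₀ - j) + (2 * j + 1) = 2 * s₀ + 1 := by omega
      have hsN : (s₀ - j) + (2 * j + 1) ≤ N := by omega
      obtain ⟨h1, h2⟩ := classWeight_eval_level_le (t := 2 * s₀ + 1) hsc hsN hfge haN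
      rw [hp]
      simp only
      rw [abs_of_nonneg h1]
      exact h2
    have hpC : ∀ c ∈ C, c < g → (p f g).eval (c : ℝ) = 0 := by
      intro c hc hlt
      rw [hp]
      exact classWeight_eval_eq_zero_of_lt _ _ _ f g (a - f - g) hlt
    have hpg : g ≠ 0 → (p f g).eval 0 = 0 := by
      intro hg0
      have h := classWeight_eval_eq_zero_of_lt (((a.choose f : ℕ) : ℝ) * ((a - f).choose g : ℕ) / (N.descFactorial a : ℕ))
        ((((2 * s₀ + 1 : ℕ) : ℝ)) / 2) ((N : ℝ) - (((2 * s₀ + 1 : ℕ) : ℝ)) / 2) f g (a - f - g) (c := 0) (by omega)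
      rw [hp]; simpa using h
    have hp0 : 0 ≤ (p f g).eval 0 := by
      rcases Nat.eq_zero_or_pos g with hg0 | hgpos
      · subst hg0
        rw [hp]
        simp only
        exact classWeight_eval_zero_nonneg (by positivity) (by omega) (by omega)
      · exact (hpg (by omega)).symm.le
    have hGs : ∀ x ∈ Icc (0 : ℤ) ((2 * (s₀ - f - g / 2) + (1 - g % 2) : ℕ) : ℤ),
        |(fun x : ℤ => ψ (x + ((2 * f + g : ℕ) : ℤ))) x| ≤ G := by
      intro x hx
      rw [mem_Icc] at hx
      refine hG _ (mem_Icc.2 ⟨by push_cast; omega, ?_⟩)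
      have : ((2 * (s₀ - f - g / 2) + (1 - g % 2) : ℕ) : ℤ) + ((2 * f + g : ℕ) : ℤ) = ((2 * s₀ + 1 : ℕ) : ℤ) := by
        rw [← Nat.cast_add]; congr 1; omega
      push_cast at this ⊢; omega
    have hψ0s : ∀ x ∈ Icc (0 : ℤ) ((2 * (s₀ - f - g / 2) + (1 - g % 2) : ℕ) : ℤ),
        0 ≤ (fun x : ℤ => ψ (x + ((2 * f + g : ℕ) : ℤ))) x := by
      intro x hx
      rw [mem_Icc] at hx
      refine hψ0 _ (mem_Icc.2 ⟨by push_cast; omega, ?_⟩)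
      have : ((2 * (s₀ - f - g / 2) + (1 - g % 2) : ℕ) : ℤ) + ((2 * f + g : ℕ) : ℤ) = ((2 * s₀ + 1 : ℕ) : ℤ) := by
        rw [← Nat.cast_add]; congr 1; omega
      push_cast at this ⊢; omega
    have h151 := tiltedSmallBlock_levelSum_le hπ hπ' hdes hS' hN' H h0' hb' (s₀ := s₀ - f - g / 2)
      (c₀ := 1 - g % 2) (i₀ := g / 2) (g := g) (D' := D') (R := R) (by omega) (by omega) (by omega) hR
      (by omega) (by omega) hq _ hGs hψ0s lam u₀ (Lf f) hlam hu₀ (hLf f hf') (p f g) hdeg hp0 hpg hpC hP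
    rw [ht', ← hqdef, ← hKc] at h151
    refine h151.trans ?_
    have hsq : (4 * ((2 * s₀ + 1 - (2 * f + g) : ℕ) : ℝ) + ((2 * s₀ + 1 : ℕ) : ℝ) + 5 * T + 4) ^ 2 ≤
        (5 * ((2 * s₀ + 1 : ℕ) : ℝ) + 5 * T + 4) ^ 2 := by
      have h1 : ((2 * s₀ + 1 - (2 * f + g) : ℕ) : ℝ) ≤ ((2 * s₀ + 1 : ℕ) : ℝ) := by
        exact_mod_cast Nat.sub_le _ _
      have h0 : (0 : ℝ) ≤ 4 * ((2 * s₀ + 1 - (2 * f + g) : ℕ) : ℝ) + ((2 * s₀ + 1 : ℕ) : ℝ) + 5 * T + 4 := by positivity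
      exact pow_le_pow_left₀ h0 (by linarith) 2
    refine mul_le_mul_of_nonneg_left ?_ (by positivity)
    refine mul_le_mul_of_nonneg_right ?_ (by positivity)
    exact mul_le_mul_of_nonneg_left hsq hG0
  -- STEP C: `|PM|·Σ_U W F = Σ_c w_c φ(c)` and the class sum
  have hPM : (Fintype.card (PMatch n) : ℝ) ≠ 0 :=
    Nat.cast_ne_zero.2 (Fintype.card_pos_iff.2 ⟨M⟩).ne'
  rw [designValue_eq_shellAvg (2 * s₀ + 1) hdes.1 C w M F, ← mul_assoc, mul_inv_cancel₀ hPM, one_mul]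
  simp only [← shellIn_univ]
  calc ∑ c ∈ C, w c * φ c
      = ∑ c ∈ C, ∑ f ∈ range (a + 1), ∑ g ∈ range (a - f + 1), w c * ((p f g).eval (c : ℝ) * Φ f g c) := by
        refine sum_congr rfl fun c hc => ?_
        rw [hsplit c hc, mul_sum]
        refine sum_congr rfl fun f _ => ?_
        rw [mul_sum]
    _ = ∑ f ∈ range (a + 1), ∑ g ∈ range (a - f + 1), ∑ c ∈ C, w c * ((p f g).eval (c : ℝ) * Φ f g c) := by
        rw [sum_comm]
        refine sum_congr rfl fun f _ => ?_
        rw [sum_comm]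
    _ ≤ ∑ f ∈ range (a + 1), ∑ g ∈ range (a - f + 1),
          Bv * (((a.choose f : ℕ) : ℝ) * ((a - f).choose g : ℕ)) * Kc *
            (G * (5 * ((2 * s₀ + 1 : ℕ) : ℝ) + 5 * T + 4) ^ 2 * q ^ (D' + 1)) :=
        sum_le_sum fun f hf => sum_le_sum fun g hg => hclass f hf g hg
    _ = Bv * Kc * ((∑ f ∈ range (a + 1), ∑ g ∈ range (a - f + 1), ((a.choose f : ℕ) : ℝ) * ((a - f).choose g : ℕ)) *
          (G * (5 * ((2 * s₀ + 1 : ℕ) : ℝ) + 5 * T + 4) ^ 2 * q ^ (D' + 1))) := by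
        rw [sum_mul, mul_sum]
        refine sum_congr rfl fun f _ => ?_
        rw [sum_mul, mul_sum]
        refine sum_congr rfl fun g _ => ?_
        ring
    _ = _ := by rw [sum_choose_mul_choose_eq_three_pow, hKc]

end Main

end Summit.PneNP.PneNP.Theorems.ChebyshevTracialDesignTiltedSmallBlockClasses

end
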